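import Mathlib
import Summits.Ventures.PercRepro2.TypedTwoEdgesAtO
import Summits.Ventures.PercRepro2.TypedLBProbe

/-!
# The probe at `o ~ {u, b}`: kernel, mirror and bridge lemmas (blind cell PercRepro2, night-3 g16,
2026-08-27; NIGHT3-CERT.md §25.7)

Preparation for `TypedLBClass.lean` (the double-attachment class of `o ~ {u, b}` from the two-copy
rows): `probeB_q'` / `KBsym_eq_probe_isolated` (the symmetrised kernel of a triple whose two closed
copies have `o` isolated is the probe of the attached copy), the MIRROR probe `probeB_hb` (o, b on
the side of `a₂`: `probeB = P₁ᵐ + pdB · (2 Aᵐ + 2 crossBm + 2 sameBm)`, the root-swapped twin of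
`probeB_lb`), the state facts `st_consistent` / `st_consistent_o` / `st_lb_bits` / `st_ob_bits`,
and the bridges from the configuration kernels of `TwoCopyBHK.lean` / `TypedSpectator.lean` to the
state kernels: `crossKernel_eq_crossB` (`crossKernel a₁ a₂ b a₃`), `sameKernel_eq_sameB`
(`sameKernel a₂ a₁ b a₃`), `crossKernel_eq_crossBm` (`crossKernel a₂ a₁ b a₃`),
`sameKernel_eq_sameBm` (`sameKernel a₁ a₂ b a₃`); plus the counting lemmas
`typedCount_nonneg_of_nonneg` and `pinnedCount_congr_on`.  Own work; standard axioms.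
-/

namespace Summit.Ventures.PercRepro2

namespace CovForm

namespace TypedRed

open OneTyped OProbe Untouched TypedA3

section Kernel

/-- A copy failing `Q` is never the probe. -/
lemma probeB_q' (x y z : St) (hx : x.q' = true) : probeB x y z = 0 := by
  unfold probeB qB pdB
  simp [hx]

/-- The symmetrised kernel of a state triple whose second and third copies have `o` isolated is the
probe of the first. -/
lemma KBsym_eq_probe_isolated (x y z : St) (hy : y.Lo = false ∧ y.Ho = false)
    (hz : z.Lo = false ∧ z.Ho = false) : KBsym x y z = probeB x y z := by
  rw [KBsym_eq_probe, probeB_isolated y x z hy, probeB_isolated z x y hz]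
  ring

end Kernel

section Count

variable {E : Type*} [Fintype E] [DecidableEq E] {R : Type*} [Field R]

/-- A pointwise-nonnegative kernel has a nonnegative typed count. -/
lemma typedCount_nonneg_of_nonneg [LinearOrder R] [IsStrictOrderedRing R] (F : Finset E)
    (z : Config E) (τ : E → ℕ) (K : Config E → Config E → Config E → R) (h : ∀ x y w, 0 ≤ K x y w) :
    0 ≤ typedCount F z τ K := by
  unfold typedCount
  refine Finset.sum_nonneg fun x _ => Finset.sum_nonneg fun y _ => Finset.sum_nonneg fun w _ => ?_
  split_ifs
  · exact h x y w
  · exact le_rfl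

/-- A complementary-pair count of a kernel that is pointwise nonnegative on its support. -/
lemma pinnedCount_congr_on (G : Finset E) (z : Config E) (K K' : Config E → Config E → R)
    (h : ∀ y, (∀ e, e ∉ G → y e = z e) → K y (flipOn G y) = K' y (flipOn G y)) :
    pinnedCount G z K = pinnedCount G z K' := by
  unfold pinnedCount
  refine Finset.sum_congr rfl fun y _ => ?_
  split_ifs with hy
  · exact h y hy
  · rfl

end Count

/-! ## The mirror probe (o and b on the side of `a₂`) -/

section Mirror

open OProbe

/-- The state form of the cross-cluster kernel for `(b, a₃)` with the roots swapped:
`1_Q(y) 1_Q(z) (1_{bH}(y) − 1_{bH}(z)) (1_{3L}(z) − 1_{3L}(y))` (`crossKernel a₂ a₁ b a₃`). -/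
def crossBm (y z : St) : ℤ :=
  qB y * qB z * ((hB y.Hb - hB z.Hb) * (hB z.L3 - hB y.L3))

/-- The state form of the same-side kernel for `(b, a₃)` on the side of `a₁`
(`sameKernel a₁ a₂ b a₃`). -/
def sameBm (y z : St) : ℤ :=
  qB y * qB z * ((hB y.Lb - hB z.Lb) * (hB y.L3 - hB z.L3))

/-- The pointwise-nonnegative part of the mirror probe. -/
def lbP1m (x y z : St) : ℤ :=
  (qB x - pdB x) * (1 + sigB x.L3 x.H3) *
    (pdB y * qB z * (1 + sigB z.Lb z.Hb) + pdB z * qB y * (1 + sigB y.Lb y.Hb))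

/-- The pointwise-nonnegative part of the mirror `Ψ`. -/
def lbAm (y z : St) : ℤ := pdB y * qB z * hB y.Lb + pdB z * qB y * hB z.Lb

/-- `1 + σ ≥ 0`. -/
lemma one_add_sigB_nonneg (L H : Bool) : 0 ≤ 1 + sigB L H := by
  cases L <;> cases H <;> simp [sigB]

/-- `P₁ᵐ ≥ 0` pointwise. -/
theorem lbP1m_nonneg (x y z : St) : 0 ≤ lbP1m x y z := by
  unfold lbP1m
  refine mul_nonneg (mul_nonneg (qB_sub_pdB_nonneg x) (one_add_sigB_nonneg _ _)) ?_
  exact add_nonneg (mul_nonneg (mul_nonneg (pdB_nonneg y) (qB_nonneg z)) (one_add_sigB_nonneg _ _))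
    (mul_nonneg (mul_nonneg (pdB_nonneg z) (qB_nonneg y)) (one_add_sigB_nonneg _ _))

/-- `Aᵐ ≥ 0` pointwise. -/
theorem lbAm_nonneg (y z : St) : 0 ≤ lbAm y z := by
  unfold lbAm
  exact add_nonneg (mul_nonneg (mul_nonneg (pdB_nonneg y) (qB_nonneg z)) (hB_nonneg _))
    (mul_nonneg (mul_nonneg (pdB_nonneg z) (qB_nonneg y)) (hB_nonneg _))

/-- **The mirror probe at `o ~ {a₂, b}`**: with `o, b ∈ C(a₂)` in the probe copy and consistent
other copies, `probeB x y z = P₁ᵐ + pdB x · (2 Aᵐ + 2 crossBm + 2 sameBm)`. -/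
theorem probeB_hb (x y z : St) (hx : x.Lo = false ∧ x.Ho = true ∧ x.Lb = false ∧ x.Hb = true)
    (hy : y.L3 = true → y.H3 = true → y.q' = true) (hz : z.L3 = true → z.H3 = true → z.q' = true) :
    probeB x y z = lbP1m x y z + pdB x * (2 * lbAm y z + 2 * crossBm y z + 2 * sameBm y z) := by
  have hx3 : pdB x * sigB x.L3 x.H3 = 0 := by
    obtain ⟨q, lo, ho, lb, hb, l3, h3⟩ := x
    cases q <;> cases l3 <;> cases h3 <;> simp [pdB, sigB, St.q', St.L3, St.H3]
  have key : probeB x y z - (lbP1m x y z + pdB x * (2 * lbAm y z + 2 * crossBm y z + 2 * sameBm y z)) =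
      (pdB y * qB z * (1 + sigB z.Lb z.Hb) + pdB z * qB y * (1 + sigB y.Lb y.Hb)) *
        (pdB x * sigB x.L3 x.H3) := by
    unfold probeB phiB lbP1m lbAm crossBm sameBm
    rw [pdB_eq_of_consistent y hy, pdB_eq_of_consistent z hz]
    obtain ⟨q, lo, ho, lb, hb, l3, h3⟩ := x
    simp only [St.Lo, St.Ho, St.Lb, St.Hb] at hx
    obtain ⟨rfl, rfl, rfl, rfl⟩ := hx
    simp only [St.Lo, St.Ho, St.Lb, St.Hb, St.L3, St.H3, sigB, uB, hB, if_true, if_false,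
      Bool.false_eq_true]
    ring
  rw [hx3, mul_zero, sub_eq_zero] at key
  exact key

end Mirror

/-! ## The state of a copy with `o ~ {a₁, b}`, and the bridges to the two-copy kernels -/

section Bridges

open Classical

variable {V : Type*} {E : Type*} [DecidableEq E] {R : Type*} [Field R]

variable (ends : E → Sym2 V) (o a₁ a₂ a₃ b : V)

omit [DecidableEq E] in
/-- A state coming from a configuration is consistent: `a₃` in both root clusters forces `Q` to
fail. -/
lemma st_consistent (ω : Config E) :
    (st ends o a₁ a₂ a₃ b ω).L3 = true → (st ends o a₁ a₂ a₃ b ω).H3 = true →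
      (st ends o a₁ a₂ a₃ b ω).q' = true := by
  unfold st
  simp only [St.L3, St.H3, St.q', decide_eq_true_eq]
  intro h1 h2
  exact conn_trans h2 (conn_symm h1)

omit [DecidableEq E] in
/-- In a copy with `o ↔ a₁` and `o ↔ b` that satisfies `Q`, the probe's four `o, b` bits. -/
lemma st_lb_bits (ω : Config E) (h1 : Conn ends ω a₁ o) (hb : Conn ends ω o b)
    (hq : (st ends o a₁ a₂ a₃ b ω).q' = false) :
    (st ends o a₁ a₂ a₃ b ω).Lo = true ∧ (st ends o a₁ a₂ a₃ b ω).Ho = false ∧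
      (st ends o a₁ a₂ a₃ b ω).Lb = true ∧ (st ends o a₁ a₂ a₃ b ω).Hb = false := by
  unfold st at hq ⊢
  simp only [St.q', St.Lo, St.Ho, St.Lb, St.Hb, decide_eq_true_eq, decide_eq_false_iff_not] at hq ⊢
  refine ⟨h1, fun h2 => hq (conn_trans h2 (conn_symm h1)), conn_trans h1 hb,
    fun h2 => hq (conn_trans h2 (conn_symm (conn_trans h1 hb)))⟩

omit [DecidableEq E] in
/-- The cross-cluster kernel of `TwoCopyBHK.lean` for the pair `(b, a₃)` on states. -/
lemma crossKernel_eq_crossB (y w : Config E) :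
    crossKernel (R := R) ends a₁ a₂ b a₃ y w =
      ((crossB (st ends o a₁ a₂ a₃ b y) (st ends o a₁ a₂ a₃ b w) : ℤ) : R) := by
  unfold crossKernel crossB hB qB st St.q' St.Lb St.H3
  simp only [Set.indicator_apply, Set.mem_compl_iff, mem_connEvent, Pi.one_apply]
  have hy : Conn ends y a₁ a₂ ↔ Conn ends y a₂ a₁ := ⟨conn_symm, conn_symm⟩
  have hw : Conn ends w a₁ a₂ ↔ Conn ends w a₂ a₁ := ⟨conn_symm, conn_symm⟩
  simp only [hy, hw]
  by_cases q1 : Conn ends y a₂ a₁ <;> by_cases q2 : Conn ends w a₂ a₁ <;>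
    by_cases l1 : Conn ends y a₁ b <;> by_cases l2 : Conn ends w a₁ b <;>
    by_cases h1 : Conn ends y a₂ a₃ <;> by_cases h2 : Conn ends w a₂ a₃ <;>
    simp [q1, q2, l1, l2, h1, h2]

omit [DecidableEq E] in
/-- The same-side kernel of `TypedSpectator.lean` for the pair `(b, a₃)` on the side of `a₂`, on
states. -/
lemma sameKernel_eq_sameB (y w : Config E) :
    sameKernel (R := R) ends a₂ a₁ b a₃ y w =
      ((sameB (st ends o a₁ a₂ a₃ b y) (st ends o a₁ a₂ a₃ b w) : ℤ) : R) := by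
  unfold sameKernel sameB hB qB st St.q' St.Hb St.H3
  simp only [Set.indicator_apply, Set.mem_compl_iff, mem_connEvent, Pi.one_apply]
  by_cases q1 : Conn ends y a₂ a₁ <;> by_cases q2 : Conn ends w a₂ a₁ <;>
    by_cases l1 : Conn ends y a₂ b <;> by_cases l2 : Conn ends w a₂ b <;>
    by_cases h1 : Conn ends y a₂ a₃ <;> by_cases h2 : Conn ends w a₂ a₃ <;>
    simp [q1, q2, l1, l2, h1, h2]

omit [DecidableEq E] in
/-- In a copy with `o ↔ b`, the `o`- and `b`-bits agree. -/
lemma st_ob_bits (ω : Config E) (hb : Conn ends ω o b) :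
    (st ends o a₁ a₂ a₃ b ω).Lb = (st ends o a₁ a₂ a₃ b ω).Lo ∧
      (st ends o a₁ a₂ a₃ b ω).Hb = (st ends o a₁ a₂ a₃ b ω).Ho := by
  unfold st
  simp only [St.Lo, St.Ho, St.Lb, St.Hb]
  exact ⟨decide_eq_decide.mpr ⟨fun h1 => conn_trans h1 (conn_symm hb), fun h1 => conn_trans h1 hb⟩,
    decide_eq_decide.mpr ⟨fun h1 => conn_trans h1 (conn_symm hb), fun h1 => conn_trans h1 hb⟩⟩

omit [DecidableEq E] in
/-- A state coming from a configuration has `o` in both root clusters only when `Q` fails. -/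
lemma st_consistent_o (ω : Config E) :
    (st ends o a₁ a₂ a₃ b ω).Lo = true → (st ends o a₁ a₂ a₃ b ω).Ho = true →
      (st ends o a₁ a₂ a₃ b ω).q' = true := by
  unfold st
  simp only [St.Lo, St.Ho, St.q', decide_eq_true_eq]
  intro h1 h2
  exact conn_trans h2 (conn_symm h1)

omit [DecidableEq E] in
/-- The mirror cross-cluster kernel on states. -/
lemma crossKernel_eq_crossBm (y w : Config E) :
    crossKernel (R := R) ends a₂ a₁ b a₃ y w =
      ((crossBm (st ends o a₁ a₂ a₃ b y) (st ends o a₁ a₂ a₃ b w) : ℤ) : R) := by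
  unfold crossKernel crossBm hB qB st St.q' St.Hb St.L3
  simp only [Set.indicator_apply, Set.mem_compl_iff, mem_connEvent, Pi.one_apply]
  by_cases q1 : Conn ends y a₂ a₁ <;> by_cases q2 : Conn ends w a₂ a₁ <;>
    by_cases l1 : Conn ends y a₂ b <;> by_cases l2 : Conn ends w a₂ b <;>
    by_cases h1 : Conn ends y a₁ a₃ <;> by_cases h2 : Conn ends w a₁ a₃ <;>
    simp [q1, q2, l1, l2, h1, h2]

omit [DecidableEq E] in
/-- The mirror same-side kernel on states. -/
lemma sameKernel_eq_sameBm (y w : Config E) :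
    sameKernel (R := R) ends a₁ a₂ b a₃ y w =
      ((sameBm (st ends o a₁ a₂ a₃ b y) (st ends o a₁ a₂ a₃ b w) : ℤ) : R) := by
  unfold sameKernel sameBm hB qB st St.q' St.Lb St.L3
  simp only [Set.indicator_apply, Set.mem_compl_iff, mem_connEvent, Pi.one_apply]
  have hy : Conn ends y a₁ a₂ ↔ Conn ends y a₂ a₁ := ⟨conn_symm, conn_symm⟩
  have hw : Conn ends w a₁ a₂ ↔ Conn ends w a₂ a₁ := ⟨conn_symm, conn_symm⟩
  simp only [hy, hw]
  by_cases q1 : Conn ends y a₂ a₁ <;> by_cases q2 : Conn ends w a₂ a₁ <;>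
    by_cases l1 : Conn ends y a₁ b <;> by_cases l2 : Conn ends w a₁ b <;>
    by_cases h1 : Conn ends y a₁ a₃ <;> by_cases h2 : Conn ends w a₁ a₃ <;>
    simp [q1, q2, l1, l2, h1, h2]

end Bridges

end TypedRed

end CovForm

end Summit.Ventures.PercRepro2
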